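import Summits.RiemannHypothesis.RiemannHypothesis.Theses.SignCone
import Summits.RiemannHypothesis.RiemannHypothesis.Theorems.SignConeConeMagnificationSplit

/-!
# `MagnificationOfSlackDesign` (route SignCone, item stmt-RiemannHypothesis-18010)

The support item `MagnificationOfSlackDesign : SlackDesign → ConeMagnification` of route
`route-RiemannHypothesis-SignCone` is, after unfolding, literally the type of the landed theorem
`Summit.RiemannHypothesis.RiemannHypothesis.Theorems.SignConeConeMagnification.ConeMagnification_of_slackDesign`
(`Theorems/SignConeConeMagnificationSplit.lean`): the 2001 magnification chain W-MAG
(slack-cone compactness, fake PNT, Chebyshev, continuation, Laplace positivity, Carathéodory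
majorant, finite deficit spine, Landau transfer) certified modulo its analytic core `SlackDesign`.
This file closes the item by that one line.
-/

-- `Summit.RiemannHypothesis.RiemannHypothesis.…` repeats a namespace component by design (D-0017 layout).
set_option linter.dupNamespace false

namespace Summit.RiemannHypothesis.RiemannHypothesis.Theorems

/-- **Item `MagnificationOfSlackDesign`** (stmt-RiemannHypothesis-18010): `SlackDesign → ConeMagnification`,
i.e. unit slack ⇒ design data (the analytic core, W-MAG Thm 3.1) implies magnification on the slack
cones (W-MAG Thm 1.2).  Proof: the landed composition `ConeMagnification_of_slackDesign`
(= `ConeMagnification_of_subs ∘ stub_deficitOfDesign`). -/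
theorem magnificationOfSlackDesign_proof :
    Summit.RiemannHypothesis.RiemannHypothesis.Theses.SignCone.MagnificationOfSlackDesign := by
  unfold Summit.RiemannHypothesis.RiemannHypothesis.Theses.SignCone.MagnificationOfSlackDesign
  exact SignConeConeMagnification.ConeMagnification_of_slackDesign

end Summit.RiemannHypothesis.RiemannHypothesis.Theorems
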